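import Summits.SmoothPoincare4.SmoothPoincare4.Theses.SymplecticOrigami
import Summits.SmoothPoincare4.SmoothPoincare4.Theorems.SymplecticOrigamiFoldedSphereFoldExistenceFoldPullbackMain
import Literature.Topology.FourManifolds.HomotopyS4FoldMap

/-!
# `FoldedSphereFoldExistence` (rung 0 of route SymplecticOrigami): reduction to Eliashberg's
# equidimensional folding theorem

Item `stmt-SmoothPoincare4-14076`: every smooth homotopy 4-sphere `M` carries a folded symplectic
form (`Literature.Geometry.Symplectic.IsFoldedForm`, Cannas da Silva–Guillemin–Pires 2010
Def. 2.1) whose folding hypersurface is a chart 3-sphere `n ↦ e n`, `e : ℝ⁴ → M` a smooth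
embedding. In print this is Cannas da Silva 2010 (Thm. 2 with Lemma 3); the shortest printed
route for a homotopy sphere needs no symplectic h-principle at all: a map `f : M → ℝ⁴` folding
exactly along `e(S³)` (Eliashberg's equidimensional folding theorem) pulls `ω₀` back to such a
form ("The pullback of a symplectic form by a `Z`-immersion is a folded symplectic form with
folding hypersurface `Z`", Cannas da Silva 2010, §1). This file:

* `foldedSphereFoldExistence_of_eliashbergFoldMap` — the item follows from the NAMED FACT
  `eliashberg_foldMap_homotopySphere_four` (existence of such a fold map on every homotopy
  4-sphere; Eliashberg 1970 = Gromov 1986 §2.1.3 (D), with the formal datum supplied by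
  Kervaire–Milnor 1963 Thm. 3.1 and the Euler-number count of Cannas da Silva 2010 §4) through
  the PROVED fold-map pull-back lemma `isFoldedForm_pullback_of_foldMap`; the item is thereby
  closed modulo that one differential-topological fact (conditional result);
* (companion file `…OfDiffeo.lean`, unconditional sanity: the conclusion holds for every `M`
  diffeomorphic to `S⁴`, so `SmoothPoincare4 → FoldedSphereFoldExistence`.)
-/

noncomputable section

-- the prescribed namespace `Summit.<P>.<Sub>.…` duplicates `SmoothPoincare4` (P = Sub)
set_option linter.dupNamespace false

open scoped Manifold ContDiff Topology ContinuousMap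

namespace Summit.SmoothPoincare4.SmoothPoincare4.Theorems

/-! ### The named fact: fold maps of homotopy 4-spheres along a chart 3-sphere -/

/-- **`FoldedSphereFoldExistence` from Eliashberg's fold map** (Cannas da Silva 2010, §1: "The
pullback of a symplectic form by a `Z`-immersion is a folded symplectic form with folding
hypersurface `Z`", here `ω₀` on `ℝ⁴` and `Z = e(S³)`): GIVEN the named fact
`eliashberg_foldMap_homotopySphere_four` (a fold map `f : M → ℝ⁴` along a chart 3-sphere on
every homotopy 4-sphere), `s = f^*ω₀` is the required folded symplectic form, by the proved
pull-back lemma `isFoldedForm_pullback_of_foldMap`; `e` is a smooth embedding by the immersion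
criterion (injective differential, `isImmersion_of_injective_mfderiv`). Conditional on the named
fact only. [cite: Cannasdasilva2010, §1 and Lemma 4] -/
theorem foldedSphereFoldExistence_of_eliashbergFoldMap
    (h : Literature.Topology.FourManifolds.eliashberg_foldMap_homotopySphere_four) :
    Summit.SmoothPoincare4.SmoothPoincare4.Theses.SymplecticOrigami.FoldedSphereFoldExistence := by
  intro M _ _ _ _ _ hM
  obtain ⟨e, f, he, hemb, hde, hf, hreg, hfold⟩ := h M hM
  exact ⟨Literature.Geometry.Kaehler.MForm.pullback (𝓡 4) f
      Literature.Geometry.Symplectic.stdSymplecticMForm, e,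
    ⟨Literature.Topology.FourManifolds.isImmersion_of_injective_mfderiv he (by simp) hde, hemb⟩,
    Summit.SmoothPoincare4.SmoothPoincare4.Theorems.FoldedSphereFoldExistence.isFoldedForm_pullback_of_foldMap
      he hemb hde hf hreg hfold⟩

end Summit.SmoothPoincare4.SmoothPoincare4.Theorems

end
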